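import Summits.Ventures.CertifiedArithmetic.LowPrec.GemmLevel2TRowsE2M1
import HarnessLib

/-!
# GEMM worst case LXVIII-c — THE LEVEL-`2T` FAMILY OVER ANY GRID ALPHABET; binary32 rows of the six
# product alphabets: the first regime ends at `k = 2^23`

HONEST FRAMING (venture CertifiedArithmetic / cell `pub-lowprec`): certified error envelopes and
provably optimal rounding/accumulation schemes for low-precision formats under stated cost models;
every table by two implementations; no hardware or vendor claims.

`gemm.tex` Prop. p:level2T (iv).  File LXVIII-a (`GemmLevel2TWord`) computes the climbing word
`A, B, M^{×j}, C, 3^{×c}, 2, (-2)^{×r}` (grid units `2^-G`) in ANY format and over ANY grid alphabet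
`(G, M, m₀)`; file LXVIII-b drew the rows of `Π(E2M1,E2M1)`.  Here the same word is a row of every
worst-case function `W` that dominates the relative error over the words of an alphabet `L`
containing its seven letters (`le_gridW_level2T`, the row engine of file LXII-c):

  `W(j + 1 + k) ≥ (8k - T + v - 7) / (8k + 5T + 3v - 5)`,  `A + B + Mj + C = T + v ≡ 3 (mod 4)`,
  `M(j+1) + m₀ < T`, `4k ≥ T + 11 - v`  (`T = 2^p`, `k = c + 2 + r`, `4c = T + 3 - v`),

and two comparisons decide the end of the first regime for such a `W` (`T ≥ 256`):
* `gridW_law_fails_of_level2T`: `k/(T+k) < W(j+1+k)` for every `2k ≥ T + 10` (`v ∈ {3, 19}`);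
* `gridW_lawMax_fails_of_level2T`: `max(k/(T+b+k), (k-1)/(T+k-1)) < W(j+1+k)` for every
  `2k ≥ T + 3`, whenever `b ≥ 4`, `3 ≤ v ≤ T/2` (`lawDefMax_lt_level2T_ratio`: cross-multiplied,
  `(3b-8)T + (2k-T)(T+4b-v-1) + (v-7)b > 0` and `(2k-T-2)(T-v-1) > 0`).

binary32 (`p = 24`, `T = 2^24`), the six product alphabets of the cell (files LXII-c/d, LXIV):

* E2M1² `(2, 144, 9)`, `W (116508+k)`: entry `3, 64, 144^{×116507}, 144` (`v = 3`); the law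
  `k/(2^24+k)` of `worstP_Binary32_firstRegime` (`1 ≤ k ≤ 2^23`) fails for every `k ≥ 2^23 + 5`;
* E2M3² `(6, 3600, 225)`, `W⁶ (4660+k)`: entry `1456, 3360, 3600^{×4659}, 3` (`v = 3`);
  `k/(2^24+k)` (`worst6P_Binary32_firstRegime`) fails for every `k ≥ 2^23 + 5`;
* E3M2² `(8, 200704, 49)`, `W⁸ (83+k)`: entry `147456, 172032, 200704^{×82}, 3` (`v = 3`);
  `k/(2^24+k)` (`worst8P_Binary32_firstRegime`) fails for every `k ≥ 2^23 + 5`;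
* E2M3·E2M1 `(4, 720, 45)`, `W⁴ (23301+k)`: entry `480, 720, 720^{×23300}, 27` (`v = 11`);
  `max(k/(2^24+4+k), (k-1)/(2^24+k-1))` (`worst4P_Binary32_law_all`) fails for every `k ≥ 2^23 + 2`;
* E3M2·E2M1 `(5, 5376, 21)`, `W⁵ (3120+k)`: entry `4608, 5376, 5376^{×3119}, 3` (`v = 515`);
  `max(k/(2^24+512+k), (k-1)/(2^24+k-1))` (`worst5P_Binary32_law_all`) fails for every
  `k ≥ 2^23 + 2`;
* E3M2·E2M3 `(7, 26880, 105)`, `W⁷ (624+k)`: entry `4096, 26880, 26880^{×623}, 3` (`v = 3`);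
  `k/(2^24+k)` (`worst7P_Binary32_firstRegime`) fails for every `k ≥ 2^23 + 5`.

So for each of the six alphabets the first regime of the products accumulated in binary32 ends at
`k = 2^23 = ½u⁻¹` up to at most four lengths (E3M2·E2M1: no entry closer to `T` than `T + 512` from
below, files LXII-d/LXIV, whence `v = 515`).  The windows `2^23 < k ≤ 2^23 + 4` (resp.
`k = 2^23 + 1`) are decided by neither theorem.  No numerics (`decide` on membership, constants).

References: [BoldoEtAl2023, Thm 4.5], [LangeRump2019] (the restart bound `ku/(1+ku)`, `k ≤ ½u⁻¹`),
[RouhaniEtAl2023MX, Table 1] (the formats), [IEEE7542019, §4.3.1]; cell documents `gemm.tex`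
Props. p:fpA, p:fpP, p:level2T and `GEMM-BOUNDS.md` §4 (Table S4F-end).
-/

namespace Summit.Ventures.CertifiedArithmetic.LowPrec.Gemm

open Literature.ComputerArithmetic.FloatingPoint
open Literature.ComputerArithmetic.FloatingPoint.MiniFloat
open Literature.ComputerArithmetic.FloatingPoint.MiniFloat.ThetaLaw
open Finset

/-! ### The third rational comparison: deficient-or-late first-regime value vs the family -/

/-- For `T ≥ 256`, `b ≥ 4`, `3 ≤ v ≤ T/2` and `2k ≥ T + 3`:
`max(k/(T+b+k), (k-1)/(T+k-1)) < (8k-T+v-7)/(8k+5T+3v-5)` (cross-multiplied: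
`(b-4)(3T+v-7) + (2k-T-3)(T+4b-v-1) + 7T + 12b + v - 31 > 0` and `(2k-T-2)(T-v-1) > 0`). [cell] -/
theorem lawDefMax_lt_level2T_ratio {T k b v : ℚ} (hT : 256 ≤ T) (hb : 4 ≤ b) (hv : 3 ≤ v)
    (hvT : 2 * v ≤ T) (hk : T + 3 ≤ 2 * k) :
    max (k / (T + b + k)) ((k - 1) / (T + k - 1))
      < (8 * k - T + v - 7) / (8 * k + 5 * T + 3 * v - 5) := by
  refine max_lt ?_ ?_
  · rw [div_lt_div_iff₀ (by linarith) (by linarith)]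
    nlinarith [mul_nonneg (by linarith : (0 : ℚ) ≤ b - 4) (by linarith : (0 : ℚ) ≤ 3 * T + v - 7),
      mul_nonneg (by linarith : (0 : ℚ) ≤ 2 * k - T - 3)
        (by linarith : (0 : ℚ) ≤ T + 4 * b - v - 1)]
  · rw [div_lt_div_iff₀ (by linarith) (by linarith)]
    nlinarith [mul_pos (by linarith : (0 : ℚ) < 2 * k - T - 2) (by linarith : (0 : ℚ) < T - v - 1)]

/-! ### The row engine at level `2T`: any alphabet `L` holding the seven letters, any `W` on top -/

section RowsL2T

variable {G M m0 E : ℕ} {φ : Format} {L : ℚ → Prop} {W : ℕ → ℚ}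
  (hWle : ∀ x : ℕ → ℚ, (∀ j, L (x j)) → ∀ m, relErr φ x m ≤ W m)
  (hq : φ.qexp ≤ -(G : ℤ)) (hR : (2 : ℚ) ^ (φ.manBits + E + 3) ≤ φ.maxRat)
  (hm0M : m0 ≤ M) (hMT : M ≤ 2 ^ (φ.manBits + 1)) (hm0 : 3 ≤ m0) (hMev : M % 2 = 0)
include hWle hq hR hm0M hMT hm0 hMev

/-- THE LEVEL-`2T` ROW OF ANY GRID ALPHABET: if `L` holds `A, B, M, C, 3, 2, -2` (grid units `2^-G`,
`A, B, C ≤ M` even or `≤ m₀`), `M(j+1) + m₀ < T`, `A + B + Mj + C = T + v` with `v ≡ 3 (mod 4)`,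
`v < T`, then `(8k - T + v - 7)/(8k + 5T + 3v - 5) ≤ W(j + 1 + k)` for every `4k ≥ T + 11 - v`
(`k = c + 2 + r`, `4c = T + 3 - v`; `relErr_cw` of file LXVIII-a).
[cell, gemm.tex Prop. p:level2T] -/
theorem le_gridW_level2T {j A B C v k : ℕ} (hLA : L ((A : ℚ) / 2 ^ G)) (hLB : L ((B : ℚ) / 2 ^ G))
    (hLM : L ((M : ℚ) / 2 ^ G)) (hLC : L ((C : ℚ) / 2 ^ G)) (hL3 : L (3 / 2 ^ G))
    (hL2 : L (2 / 2 ^ G)) (hLn2 : L (-2 / 2 ^ G)) (hA : A ≤ M ∧ (A % 2 = 0 ∨ A ≤ m0))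
    (hB : B ≤ M ∧ (B % 2 = 0 ∨ B ≤ m0)) (hC : C ≤ M ∧ (C % 2 = 0 ∨ C ≤ m0))
    (hT : M * (j + 1) + m0 < 2 ^ (φ.manBits + 1))
    (hV : A + B + M * j + C = 2 ^ (φ.manBits + 1) + v) (hv4 : v % 4 = 3)
    (hv : v < 2 ^ (φ.manBits + 1)) (hk : 2 ^ (φ.manBits + 1) + 11 ≤ 4 * k + v) :
    ((8 * k : ℚ) - 2 ^ (φ.manBits + 1) + v - 7) / (8 * k + 5 * 2 ^ (φ.manBits + 1) + 3 * v - 5)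
      ≤ W (j + 1 + k) := by
  have hmb : 1 ≤ φ.manBits := one_le_manBits_of hm0M (le_trans (by norm_num) hm0) hT
  have h4T : 4 ∣ 2 ^ (φ.manBits + 1) := ⟨2 ^ (φ.manBits - 1), by
    rw [show (4 : ℕ) = 2 ^ 2 by norm_num, ← pow_add]; congr 1; omega⟩
  obtain ⟨c, hc⟩ : ∃ c, 2 ^ (φ.manBits + 1) + 3 = v + 4 * c :=
    ⟨(2 ^ (φ.manBits + 1) + 3 - v) / 4, by omega⟩
  obtain ⟨r, hr⟩ : ∃ r, k = c + 2 + r := ⟨k - (c + 2), by omega⟩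
  have h := relErr_cw (G := G) (M := M) (m0 := m0) (E := E) (c := c) hq hR hm0M hMT hm0 hMev
    (V := 2 ^ (φ.manBits + 1) + v) hA hB hC hT hV (Nat.le_add_right _ _) (by omega) (by omega) r
  rw [show j + 1 + k = j + 3 + c + r by omega]
  have hr' : (k : ℚ) = c + 2 + r := by exact_mod_cast hr
  have hc' : (2 : ℚ) ^ (φ.manBits + 1) + 3 = v + 4 * c := by exact_mod_cast hc
  have en : (8 * k : ℚ) - 2 ^ (φ.manBits + 1) + v - 7 = 4 * ((c + 3 + 2 * r : ℕ) : ℚ) := by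
    push_cast; linear_combination 8 * hr' - hc'
  have ed : (8 * k : ℚ) + 5 * 2 ^ (φ.manBits + 1) + 3 * v - 5
      = 4 * ((2 ^ (φ.manBits + 1) + v + 3 * c + 2 + 2 * r : ℕ) : ℚ) := by
    push_cast; linear_combination 8 * hr' + hc'
  calc _ = relErr φ (cw G M j A B C c) (j + 3 + c + r) := by
        rw [h, en, ed, mul_div_mul_left _ _ (by norm_num : (4 : ℚ) ≠ 0)]
    _ ≤ _ := hWle _ (cw_forall hLA hLB hLM hLC hL3 hL2 hLn2) _

/-- THE FIRST REGIME OF `W` ENDS (plain entry, `v ∈ {3, 19}`, `p ≥ 8`): `k/(T+k) < W(j+1+k)` for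
every `2k ≥ T + 10`. [cell, gemm.tex Prop. p:level2T] -/
theorem gridW_law_fails_of_level2T (hm : 7 ≤ φ.manBits) {j A B C v k : ℕ}
    (hLA : L ((A : ℚ) / 2 ^ G)) (hLB : L ((B : ℚ) / 2 ^ G)) (hLM : L ((M : ℚ) / 2 ^ G))
    (hLC : L ((C : ℚ) / 2 ^ G)) (hL3 : L (3 / 2 ^ G)) (hL2 : L (2 / 2 ^ G))
    (hLn2 : L (-2 / 2 ^ G)) (hA : A ≤ M ∧ (A % 2 = 0 ∨ A ≤ m0))
    (hB : B ≤ M ∧ (B % 2 = 0 ∨ B ≤ m0)) (hC : C ≤ M ∧ (C % 2 = 0 ∨ C ≤ m0))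
    (hT : M * (j + 1) + m0 < 2 ^ (φ.manBits + 1))
    (hV : A + B + M * j + C = 2 ^ (φ.manBits + 1) + v) (hv : v = 3 ∨ v = 19)
    (hk : 2 ^ (φ.manBits + 1) + 10 ≤ 2 * k) :
    (k : ℚ) / (2 ^ (φ.manBits + 1) + k) < W (j + 1 + k) := by
  have hT256 : 256 ≤ 2 ^ (φ.manBits + 1) :=
    le_trans (by norm_num) (Nat.pow_le_pow_right (by norm_num) (by omega : 8 ≤ φ.manBits + 1))
  have hvq : (v : ℚ) = 3 ∨ (v : ℚ) = 19 :=
    hv.imp (fun h => by exact_mod_cast h) (fun h => by exact_mod_cast h)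
  exact lt_of_lt_of_le
    (law_lt_level2T_ratio (T := (2 : ℚ) ^ (φ.manBits + 1)) (k := (k : ℚ)) (v := (v : ℚ))
      (by exact_mod_cast hT256) (by exact_mod_cast hk) hvq)
    (le_gridW_level2T hWle hq hR hm0M hMT hm0 hMev (k := k) hLA hLB hLM hLC hL3 hL2 hLn2 hA hB
      hC hT hV (by omega) (by omega) (by omega))

/-- THE FIRST REGIME OF `W` ENDS (deficient entry `T + b + 1`, `b ≥ 4`, or late entry;
`3 ≤ v ≤ T/2`, `p ≥ 8`): `max(k/(T+b+k), (k-1)/(T+k-1)) < W(j+1+k)` for every `2k ≥ T + 3`.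
[cell, gemm.tex Prop. p:level2T] -/
theorem gridW_lawMax_fails_of_level2T (hm : 7 ≤ φ.manBits) {j A B C b v k : ℕ}
    (hLA : L ((A : ℚ) / 2 ^ G)) (hLB : L ((B : ℚ) / 2 ^ G)) (hLM : L ((M : ℚ) / 2 ^ G))
    (hLC : L ((C : ℚ) / 2 ^ G)) (hL3 : L (3 / 2 ^ G)) (hL2 : L (2 / 2 ^ G))
    (hLn2 : L (-2 / 2 ^ G)) (hA : A ≤ M ∧ (A % 2 = 0 ∨ A ≤ m0))
    (hB : B ≤ M ∧ (B % 2 = 0 ∨ B ≤ m0)) (hC : C ≤ M ∧ (C % 2 = 0 ∨ C ≤ m0))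
    (hT : M * (j + 1) + m0 < 2 ^ (φ.manBits + 1))
    (hV : A + B + M * j + C = 2 ^ (φ.manBits + 1) + v) (hb : 4 ≤ b) (hv3 : 3 ≤ v)
    (hv4 : v % 4 = 3) (hvT : 2 * v ≤ 2 ^ (φ.manBits + 1)) (hk : 2 ^ (φ.manBits + 1) + 3 ≤ 2 * k) :
    max ((k : ℚ) / (2 ^ (φ.manBits + 1) + b + k)) (((k : ℚ) - 1) / (2 ^ (φ.manBits + 1) + k - 1))
      < W (j + 1 + k) := by
  have hT256 : 256 ≤ 2 ^ (φ.manBits + 1) :=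
    le_trans (by norm_num) (Nat.pow_le_pow_right (by norm_num) (by omega : 8 ≤ φ.manBits + 1))
  exact lt_of_lt_of_le
    (lawDefMax_lt_level2T_ratio (T := (2 : ℚ) ^ (φ.manBits + 1)) (k := (k : ℚ)) (b := (b : ℚ))
      (v := (v : ℚ)) (by exact_mod_cast hT256) (by exact_mod_cast hb) (by exact_mod_cast hv3)
      (by exact_mod_cast hvT) (by exact_mod_cast hk))
    (le_gridW_level2T hWle hq hR hm0M hMT hm0 hMev (k := k) hLA hLB hLM hLC hL3 hL2 hLn2 hA hB
      hC hT hV hv4 (by omega) (by omega))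

end RowsL2T

/-! ### binary32, `Π(E2M1,E2M1)`: `T = 2^24 = 144·116508 + 64` (`p = 24 ≡ 0 (mod 6)`, `v = 3`) -/

/-- FP4 PRODUCTS INTO binary32 BEYOND THE FIRST REGIME: `(2k - 4194305)/(2k + 20971521) ≤
W_24(116509 + k)` for every `k ≥ 2^22 + 2` (index `116508 + k`; the word
`¾, 16, 36^{×116507}, 36, ¾^{×2^22}, ½, -½, …`). [cell, gemm.tex Prop. p:level2T] -/
theorem le_worstP_Binary32_level2T {k : ℕ} (hk : 2 ^ 22 + 2 ≤ k) :
    ((2 * k : ℚ) - 4194305) / (2 * k + 20971521)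
      ≤ worstRelErrE2M1 Format.Binary32 (116508 + k) := by
  obtain ⟨h1, h2, h3, h4⟩ := Binary32_hyps
  have hT : 2 ^ (Format.Binary32.manBits + 1) = 16777216 := by rw [pow_succ, h4]; norm_num
  have w := le_worstP_level2T (E := 7) h2 h3 (j0 := 116508) (A := 3) (B := 64) (v := 3) (k := k)
    (by norm_num [piE2M1]) (by norm_num [piE2M1]) (by omega) (by norm_num) (by omega) (by decide)
    (by omega) (by omega)
  rw [show Format.Binary32.manBits + 1 = 24 from rfl] at w
  refine le_trans (le_of_eq ?_) w
  have hk' : (4194306 : ℚ) ≤ k := by exact_mod_cast hk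
  rw [div_eq_div_iff (by linarith) (by norm_num; linarith)]
  ring

/-- THE FIRST REGIME OF FP4 PRODUCTS IN binary32 ENDS AT `k = 2^23`: the law `k/(2^24 + k)` of
`worstP_Binary32_firstRegime` (`1 ≤ k ≤ 2^23`) is STRICTLY below `W_24(116509 + k)` for every
`k ≥ 2^23 + 5`. [cell, gemm.tex Prop. p:level2T] -/
theorem worstP_Binary32_law_fails {k : ℕ} (hk : 2 ^ 23 + 5 ≤ k) :
    (k : ℚ) / (2 ^ 24 + k) < worstRelErrE2M1 Format.Binary32 (116508 + k) := by
  obtain ⟨h1, h2, h3, h4⟩ := Binary32_hyps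
  have hT : 2 ^ (Format.Binary32.manBits + 1) = 16777216 := by rw [pow_succ, h4]; norm_num
  have h := firstRegime_fails_zero (E := 7) h2 h3 h1 (j0 := 116508) (by omega) (k := k) (by omega)
  rwa [show Format.Binary32.manBits + 1 = 24 from rfl] at h

/-! ### binary32, `Π(E2M3,E2M3)` `(6, 3600, 225)`: `n₀ = 4661`, entry `2^24 + 3` -/

/-- E2M3² INTO binary32 BEYOND THE FIRST REGIME: `(2k - 4194305)/(2k + 20971521) ≤ W⁶_24(4661 + k)`
for every `k ≥ 2^22 + 2` (index `4660 + k`). [cell, gemm.tex Prop. p:level2T] -/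
theorem le_worst6P_Binary32_level2T {k : ℕ} (hk : 2 ^ 22 + 2 ≤ k) :
    ((2 * k : ℚ) - 4194305) / (2 * k + 20971521) ≤ worstRelErrE2M3 Format.Binary32 (4660 + k) := by
  obtain ⟨h1, h2, h3, h4⟩ := Binary32_hyps6
  have hT : 2 ^ (Format.Binary32.manBits + 1) = 16777216 := by rw [pow_succ, h4]; norm_num
  have w := le_gridW_level2T (G := 6) (M := 3600) (m0 := 225) (E := 11)
    (worst6P_spec Format.Binary32).1 h2 h3 (by norm_num) (e2m3_MT h1) (by norm_num) (by norm_num)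
    (j := 4659) (A := 1456) (B := 3360) (C := 3) (v := 3) (k := k)
    (mem_piE2M3_nat (by decide)) (mem_piE2M3_nat (by decide)) (mem_piE2M3_nat (by decide))
    (mem_piE2M3_nat (by decide)) (by simpa using mem_piE2M3_nat (A := 3) (by decide))
    (by simpa using mem_piE2M3_nat (A := 2) (by decide))
    (List.mem_map.mpr ⟨-2, by decide, by norm_num⟩) (by norm_num) (by norm_num) (by norm_num)
    (by omega) (by omega) (by decide) (by omega) (by omega)
  rw [show Format.Binary32.manBits + 1 = 24 from rfl] at w
  refine le_trans (le_of_eq ?_) w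
  have hk' : (4194306 : ℚ) ≤ k := by exact_mod_cast hk
  rw [div_eq_div_iff (by linarith) (by norm_num; linarith)]
  ring

/-- THE FIRST REGIME OF E2M3² IN binary32 ENDS AT `k = 2^23`: `k/(2^24 + k)`
(`worst6P_Binary32_firstRegime`, `1 ≤ k ≤ 2^23`) `< W⁶_24(4661 + k)` for every `k ≥ 2^23 + 5`.
[cell, gemm.tex Prop. p:level2T] -/
theorem worst6P_Binary32_law_fails {k : ℕ} (hk : 2 ^ 23 + 5 ≤ k) :
    (k : ℚ) / (2 ^ 24 + k) < worstRelErrE2M3 Format.Binary32 (4660 + k) := by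
  obtain ⟨h1, h2, h3, h4⟩ := Binary32_hyps6
  have hT : 2 ^ (Format.Binary32.manBits + 1) = 16777216 := by rw [pow_succ, h4]; norm_num
  have h := gridW_law_fails_of_level2T (G := 6) (M := 3600) (m0 := 225) (E := 11)
    (worst6P_spec Format.Binary32).1 h2 h3 (by norm_num) (e2m3_MT h1) (by norm_num) (by norm_num)
    (by omega) (j := 4659) (A := 1456) (B := 3360) (C := 3) (v := 3) (k := k)
    (mem_piE2M3_nat (by decide)) (mem_piE2M3_nat (by decide)) (mem_piE2M3_nat (by decide))
    (mem_piE2M3_nat (by decide)) (by simpa using mem_piE2M3_nat (A := 3) (by decide))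
    (by simpa using mem_piE2M3_nat (A := 2) (by decide))
    (List.mem_map.mpr ⟨-2, by decide, by norm_num⟩) (by norm_num) (by norm_num) (by norm_num)
    (by omega) (by omega) (Or.inl rfl) (by omega)
  rwa [show Format.Binary32.manBits + 1 = 24 from rfl] at h

/-! ### binary32, `Π(E3M2,E3M2)` `(8, 200704, 49)`: `n₀ = 84`, entry `2^24 + 3` -/

/-- E3M2² INTO binary32 BEYOND THE FIRST REGIME: `(2k - 4194305)/(2k + 20971521) ≤ W⁸_24(84 + k)`
for every `k ≥ 2^22 + 2` (index `83 + k`). [cell, gemm.tex Prop. p:level2T] -/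
theorem le_worst8P_Binary32_level2T {k : ℕ} (hk : 2 ^ 22 + 2 ≤ k) :
    ((2 * k : ℚ) - 4194305) / (2 * k + 20971521) ≤ worstRelErrE3M2 Format.Binary32 (83 + k) := by
  obtain ⟨h1, h2, h3, h4⟩ := Binary32_hyps8
  have hT : 2 ^ (Format.Binary32.manBits + 1) = 16777216 := by rw [pow_succ, h4]; norm_num
  have w := le_gridW_level2T (G := 8) (M := 200704) (m0 := 49) (E := 17)
    (worst8P_spec Format.Binary32).1 h2 h3 (by norm_num) (e3m2_MT h1) (by norm_num) (by norm_num)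
    (j := 82) (A := 147456) (B := 172032) (C := 3) (v := 3) (k := k)
    (mem_piE3M2_nat (by decide)) (mem_piE3M2_nat (by decide)) (mem_piE3M2_nat (by decide))
    (mem_piE3M2_nat (by decide)) (by simpa using mem_piE3M2_nat (A := 3) (by decide))
    (by simpa using mem_piE3M2_nat (A := 2) (by decide))
    (List.mem_map.mpr ⟨-2, by decide, by norm_num⟩) (by norm_num) (by norm_num) (by norm_num)
    (by omega) (by omega) (by decide) (by omega) (by omega)
  rw [show Format.Binary32.manBits + 1 = 24 from rfl] at w
  refine le_trans (le_of_eq ?_) w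
  have hk' : (4194306 : ℚ) ≤ k := by exact_mod_cast hk
  rw [div_eq_div_iff (by linarith) (by norm_num; linarith)]
  ring

/-- THE FIRST REGIME OF E3M2² IN binary32 ENDS AT `k = 2^23`: `k/(2^24 + k)`
(`worst8P_Binary32_firstRegime`, `1 ≤ k ≤ 2^23`) `< W⁸_24(84 + k)` for every `k ≥ 2^23 + 5`.
[cell, gemm.tex Prop. p:level2T] -/
theorem worst8P_Binary32_law_fails {k : ℕ} (hk : 2 ^ 23 + 5 ≤ k) :
    (k : ℚ) / (2 ^ 24 + k) < worstRelErrE3M2 Format.Binary32 (83 + k) := by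
  obtain ⟨h1, h2, h3, h4⟩ := Binary32_hyps8
  have hT : 2 ^ (Format.Binary32.manBits + 1) = 16777216 := by rw [pow_succ, h4]; norm_num
  have h := gridW_law_fails_of_level2T (G := 8) (M := 200704) (m0 := 49) (E := 17)
    (worst8P_spec Format.Binary32).1 h2 h3 (by norm_num) (e3m2_MT h1) (by norm_num) (by norm_num)
    (by omega) (j := 82) (A := 147456) (B := 172032) (C := 3) (v := 3) (k := k)
    (mem_piE3M2_nat (by decide)) (mem_piE3M2_nat (by decide)) (mem_piE3M2_nat (by decide))
    (mem_piE3M2_nat (by decide)) (by simpa using mem_piE3M2_nat (A := 3) (by decide))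
    (by simpa using mem_piE3M2_nat (A := 2) (by decide))
    (List.mem_map.mpr ⟨-2, by decide, by norm_num⟩) (by norm_num) (by norm_num) (by norm_num)
    (by omega) (by omega) (Or.inl rfl) (by omega)
  rwa [show Format.Binary32.manBits + 1 = 24 from rfl] at h

/-! ### binary32, E2M3·E2M1 `(4, 720, 45)`: `n₀ = 23302`, entry `2^24 + 11` -/

/-- E2M3·E2M1 INTO binary32 BEYOND THE FIRST REGIME:
`(2k - 4194303)/(2k + 20971527) ≤ W⁴_24(23302 + k)` for every `k ≥ 2^22` (index `23301 + k`;
entry `480 + 720 + 720·23300 + 27 = 2^24 + 11`). [cell, gemm.tex Prop. p:level2T] -/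
theorem le_worst4P_Binary32_level2T {k : ℕ} (hk : 2 ^ 22 ≤ k) :
    ((2 * k : ℚ) - 4194303) / (2 * k + 20971527) ≤ worstRelErrMixA Format.Binary32 (23301 + k) := by
  obtain ⟨h1, h2, h3, h4⟩ := Binary32_hyps4
  have hT : 2 ^ (Format.Binary32.manBits + 1) = 16777216 := by rw [pow_succ, h4]; norm_num
  have w := le_gridW_level2T (G := 4) (M := 720) (m0 := 45) (E := 9)
    (worst4P_spec Format.Binary32).1 h2 h3 (by norm_num) (mixA_MT h1) (by norm_num) (by norm_num)
    (j := 23300) (A := 480) (B := 720) (C := 27) (v := 11) (k := k)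
    (piMixA_nat (by decide)) (piMixA_nat (by decide)) (piMixA_nat (by decide))
    (piMixA_nat (by decide)) (by simpa using piMixA_nat (A := 3) (by decide))
    (by simpa using piMixA_nat (A := 2) (by decide)) ⟨-2, by decide, by norm_num⟩
    (by norm_num) (by norm_num) (by norm_num) (by omega) (by omega) (by decide) (by omega)
    (by omega)
  rw [show Format.Binary32.manBits + 1 = 24 from rfl] at w
  refine le_trans (le_of_eq ?_) w
  have hk' : (4194304 : ℚ) ≤ k := by exact_mod_cast hk
  rw [div_eq_div_iff (by linarith) (by norm_num; linarith)]
  ring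

/-- THE FIRST REGIME OF E2M3·E2M1 IN binary32 ENDS AT `k = 2^23`: the closed form
`max(k/(2^24+4+k), (k-1)/(2^24+k-1))` of `worst4P_Binary32_law_all` (`1 ≤ k ≤ 2^23`) is STRICTLY
below `W⁴_24(23302 + k)` for every `k ≥ 2^23 + 2` (at `k = 2^23 + 1` the family's value is the
closed form's value `1/3`). [cell, gemm.tex Prop. p:level2T] -/
theorem worst4P_Binary32_law_fails {k : ℕ} (hk : 2 ^ 23 + 2 ≤ k) :
    max ((k : ℚ) / (2 ^ 24 + 4 + k)) (((k : ℚ) - 1) / (2 ^ 24 + k - 1))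
      < worstRelErrMixA Format.Binary32 (23301 + k) := by
  obtain ⟨h1, h2, h3, h4⟩ := Binary32_hyps4
  have hT : 2 ^ (Format.Binary32.manBits + 1) = 16777216 := by rw [pow_succ, h4]; norm_num
  have h := gridW_lawMax_fails_of_level2T (G := 4) (M := 720) (m0 := 45) (E := 9)
    (worst4P_spec Format.Binary32).1 h2 h3 (by norm_num) (mixA_MT h1) (by norm_num) (by norm_num)
    (by omega) (j := 23300) (A := 480) (B := 720) (C := 27) (b := 4) (v := 11) (k := k)
    (piMixA_nat (by decide)) (piMixA_nat (by decide)) (piMixA_nat (by decide))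
    (piMixA_nat (by decide)) (by simpa using piMixA_nat (A := 3) (by decide))
    (by simpa using piMixA_nat (A := 2) (by decide)) ⟨-2, by decide, by norm_num⟩
    (by norm_num) (by norm_num) (by norm_num) (by omega) (by omega) le_rfl (by norm_num) (by decide)
    (by omega) (by omega)
  rw [show Format.Binary32.manBits + 1 = 24 from rfl] at h
  simpa only [Nat.cast_ofNat] using h

/-! ### binary32, E3M2·E2M1 `(5, 5376, 21)`: `n₀ = 3121`, entry `2^24 + 515` -/

/-- E3M2·E2M1 INTO binary32 BEYOND THE FIRST REGIME:
`(2k - 4194177)/(2k + 20971905) ≤ W⁵_24(3121 + k)` for every `k ≥ 2^22 - 126` (index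
`3120 + k`; entry `4608 + 5376 + 5376·3119 + 3 = 2^24 + 515` — the alphabet's deficient entry
`2^24 + 513` plus `2`, files LXII-d/LXIV). [cell, gemm.tex Prop. p:level2T] -/
theorem le_worst5P_Binary32_level2T {k : ℕ} (hk : 2 ^ 22 - 126 ≤ k) :
    ((2 * k : ℚ) - 4194177) / (2 * k + 20971905) ≤ worstRelErrMixB Format.Binary32 (3120 + k) := by
  obtain ⟨h1, h2, h3, h4⟩ := Binary32_hyps5
  have hT : 2 ^ (Format.Binary32.manBits + 1) = 16777216 := by rw [pow_succ, h4]; norm_num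
  have w := le_gridW_level2T (G := 5) (M := 5376) (m0 := 21) (E := 12)
    (worst5P_spec Format.Binary32).1 h2 h3 (by norm_num) (mixB_MT h1) (by norm_num) (by norm_num)
    (j := 3119) (A := 4608) (B := 5376) (C := 3) (v := 515) (k := k)
    (piMixB_nat (by decide)) (piMixB_nat (by decide)) (piMixB_nat (by decide))
    (piMixB_nat (by decide)) (by simpa using piMixB_nat (A := 3) (by decide))
    (by simpa using piMixB_nat (A := 2) (by decide)) ⟨-2, by decide, by norm_num⟩
    (by norm_num) (by norm_num) (by norm_num) (by omega) (by omega) (by decide) (by omega)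
    (by omega)
  rw [show Format.Binary32.manBits + 1 = 24 from rfl] at w
  refine le_trans (le_of_eq ?_) w
  have hk' : (4194178 : ℚ) ≤ k := by exact_mod_cast (show 4194178 ≤ k by omega)
  rw [div_eq_div_iff (by linarith) (by norm_num; linarith)]
  ring

/-- THE FIRST REGIME OF E3M2·E2M1 IN binary32 ENDS AT `k = 2^23`: the closed form
`max(k/(2^24+512+k), (k-1)/(2^24+k-1))` of `worst5P_Binary32_law_all` (`1 ≤ k ≤ 2^23`) is STRICTLY
below `W⁵_24(3121 + k)` for every `k ≥ 2^23 + 2`. [cell, gemm.tex Prop. p:level2T] -/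
theorem worst5P_Binary32_law_fails {k : ℕ} (hk : 2 ^ 23 + 2 ≤ k) :
    max ((k : ℚ) / (2 ^ 24 + 512 + k)) (((k : ℚ) - 1) / (2 ^ 24 + k - 1))
      < worstRelErrMixB Format.Binary32 (3120 + k) := by
  obtain ⟨h1, h2, h3, h4⟩ := Binary32_hyps5
  have hT : 2 ^ (Format.Binary32.manBits + 1) = 16777216 := by rw [pow_succ, h4]; norm_num
  have h := gridW_lawMax_fails_of_level2T (G := 5) (M := 5376) (m0 := 21) (E := 12)
    (worst5P_spec Format.Binary32).1 h2 h3 (by norm_num) (mixB_MT h1) (by norm_num) (by norm_num)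
    (by omega) (j := 3119) (A := 4608) (B := 5376) (C := 3) (b := 512) (v := 515) (k := k)
    (piMixB_nat (by decide)) (piMixB_nat (by decide)) (piMixB_nat (by decide))
    (piMixB_nat (by decide)) (by simpa using piMixB_nat (A := 3) (by decide))
    (by simpa using piMixB_nat (A := 2) (by decide)) ⟨-2, by decide, by norm_num⟩
    (by norm_num) (by norm_num) (by norm_num) (by omega) (by omega) (by norm_num) (by norm_num)
    (by decide) (by omega) (by omega)
  rw [show Format.Binary32.manBits + 1 = 24 from rfl] at h
  simpa only [Nat.cast_ofNat] using h

/-! ### binary32, E3M2·E2M3 `(7, 26880, 105)`: `n₀ = 625`, entry `2^24 + 3` -/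

/-- E3M2·E2M3 INTO binary32 BEYOND THE FIRST REGIME:
`(2k - 4194305)/(2k + 20971521) ≤ W⁷_24(625 + k)` for every `k ≥ 2^22 + 2` (index `624 + k`;
entry `4096 + 26880 + 26880·623 + 3 = 2^24 + 3`). [cell, gemm.tex Prop. p:level2T] -/
theorem le_worst7P_Binary32_level2T {k : ℕ} (hk : 2 ^ 22 + 2 ≤ k) :
    ((2 * k : ℚ) - 4194305) / (2 * k + 20971521) ≤ worstRelErrMixC Format.Binary32 (624 + k) := by
  obtain ⟨h1, h2, h3, h4⟩ := Binary32_hyps7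
  have hT : 2 ^ (Format.Binary32.manBits + 1) = 16777216 := by rw [pow_succ, h4]; norm_num
  have w := le_gridW_level2T (G := 7) (M := 26880) (m0 := 105) (E := 14)
    (worst7P_spec Format.Binary32).1 h2 h3 (by norm_num) (mixC_MT h1) (by norm_num) (by norm_num)
    (j := 623) (A := 4096) (B := 26880) (C := 3) (v := 3) (k := k)
    (piMixC_nat (by decide)) (piMixC_nat (by decide)) (piMixC_nat (by decide))
    (piMixC_nat (by decide)) (by simpa using piMixC_nat (A := 3) (by decide))
    (by simpa using piMixC_nat (A := 2) (by decide)) ⟨-2, by decide, by norm_num⟩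
    (by norm_num) (by norm_num) (by norm_num) (by omega) (by omega) (by decide) (by omega)
    (by omega)
  rw [show Format.Binary32.manBits + 1 = 24 from rfl] at w
  refine le_trans (le_of_eq ?_) w
  have hk' : (4194306 : ℚ) ≤ k := by exact_mod_cast hk
  rw [div_eq_div_iff (by linarith) (by norm_num; linarith)]
  ring

/-- THE FIRST REGIME OF E3M2·E2M3 IN binary32 ENDS AT `k = 2^23`: `k/(2^24 + k)`
(`worst7P_Binary32_firstRegime`, `1 ≤ k ≤ 2^23`) `< W⁷_24(625 + k)` for every `k ≥ 2^23 + 5`.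
[cell, gemm.tex Prop. p:level2T] -/
theorem worst7P_Binary32_law_fails {k : ℕ} (hk : 2 ^ 23 + 5 ≤ k) :
    (k : ℚ) / (2 ^ 24 + k) < worstRelErrMixC Format.Binary32 (624 + k) := by
  obtain ⟨h1, h2, h3, h4⟩ := Binary32_hyps7
  have hT : 2 ^ (Format.Binary32.manBits + 1) = 16777216 := by rw [pow_succ, h4]; norm_num
  have h := gridW_law_fails_of_level2T (G := 7) (M := 26880) (m0 := 105) (E := 14)
    (worst7P_spec Format.Binary32).1 h2 h3 (by norm_num) (mixC_MT h1) (by norm_num) (by norm_num)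
    (by omega) (j := 623) (A := 4096) (B := 26880) (C := 3) (v := 3) (k := k)
    (piMixC_nat (by decide)) (piMixC_nat (by decide)) (piMixC_nat (by decide))
    (piMixC_nat (by decide)) (by simpa using piMixC_nat (A := 3) (by decide))
    (by simpa using piMixC_nat (A := 2) (by decide)) ⟨-2, by decide, by norm_num⟩
    (by norm_num) (by norm_num) (by norm_num) (by omega) (by omega) (Or.inl rfl) (by omega)
  rwa [show Format.Binary32.manBits + 1 = 24 from rfl] at h

end Summit.Ventures.CertifiedArithmetic.LowPrec.Gemm
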